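import Literature.Geometry.Riemannian.GradientSolitonIdentities
import Literature.Geometry.Lorentzian.CoordCutoffAffineMaximum
import Literature.Geometry.Lorentzian.CoordRicciEigenframe
import HarnessLib

/-!
# The Hamilton–Ivey quantity of a three-dimensional shrinker at a cut-off maximum: the point inequality

The point computation of the ELLIPTIC proof that complete three-dimensional gradient shrinking
Ricci solitons have non-negative sectional curvature (the statement of B.-L. Chen, J. Differential
Geom. 82 (2009), Cor. 2.4, for shrinkers; the pinching quantity is Hamilton–Ivey's,
R. S. Hamilton, *The formation of singularities in the Ricci flow* (1995), §24, Thm. 24.4;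
T. Ivey 1993). In the coordinate language (`MetricCoord`, metric components `G` on an open `V`
of a `3`-dimensional model space) let `Ric + Hess f = ½ G` be a gradient shrinking soliton, `x ∈ V`,
`e = (e₀,e₁,e₂)` a `G_x`-orthonormal eigenframe of `Ric_x` with eigenvalues `μ`, `e₀` the TOP
eigenvector, `Θ` a `C²` function of one variable with `Θ(f(x)) > 0`, and constants `c₀ α κ u₀` with
the cut-off affine pinching

  `Θ(f y)(c₀ G_y(w,w) + 2α Ric_y(w,w) + κ S(y) G_y(w,w)) ≤ u₀ G_y(w,w)`   (`y ∈ V`, all `w`),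

equality at `(x, e₀)`. Feeding the traced second-order condition
(`IsMetricOn.cutoff_affine_maximum_laplacian`) with Hamilton's identities on the soliton —
`(ΔRic)(e₀,e₀) − (∇_{∇f}Ric)(e₀,e₀) = μ₀ − μ₁(μ₀+μ₁−μ₂) − μ₂(μ₀+μ₂−μ₁)`
(`lapBilinAt_ricAt_self_of_soliton_eigenframe`), `ΔS = dS(∇f) + S − 2|Ric|²`
(`lapAt_scalAt_of_soliton`), `Δf = 3/2 − S` — and cancelling the `∇f`-terms with the first-order
condition in the direction `∇f` gives

* **`IsMetricOn.hamiltonIvey_at_cutoff_maximum`**: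
  `Θ · (2α T_Ric + κ T_S) ≤ −L₀ (Θ'' |∇f|² + Θ' (3/2 − S − |∇f|²)) + 2 Θ'² |∇f|² L₀ / Θ`,
  `T_Ric = μ₀ − μ₁(μ₀+μ₁−μ₂) − μ₂(μ₀+μ₂−μ₁)`, `T_S = S − 2 Σ μᵢ²`, `L₀ = c₀ + 2α μ₀ + κ S(x)`,
  all at `x`, with `|∇f|² = df(♯df)`.

With the Hamilton–Ivey coefficients (`α = e^{−S/X}(1+S/X)`, `κ = −α − e^{−S/X}`, `L₀ = X e^{−S/X}`,
`X = μ₀ − μ₁ − μ₂ > 0`) the left side is `≥ Θ X e^{−S/X}(1 + X)` (pure algebra,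
`HamiltonIveyShrinkerAlgebra.lean`), and with the shrinker normalisation `S + |∇f|² = f` the right
side is the cut-off expression `−L₀(Θ''|∇f|² + Θ'(3/2 − f)) + 2Θ'²|∇f|²L₀/Θ = O(L₀/A)`. Everything
here is proved; no definition is introduced.

## References

* R. S. Hamilton, *The formation of singularities in the Ricci flow*, Surveys in Differential
  Geometry II (1995) 7–136, §24 (the Hamilton–Ivey pinching estimate). [Hamilton1995]
* B.-L. Chen, *Strong uniqueness of the Ricci flow*, J. Differential Geom. 82 (2009), Cor. 2.4. [Chen2009]
* M. Eminenti, G. La Nave, C. Mantegazza, manuscripta math. 127 (2008), §3 (p. 7). [EminentiLanaveMantegazza2008]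
-/

noncomputable section

set_option maxSynthPendingDepth 3

open Set Filter Module
open scoped Topology ContDiff

namespace Literature.Geometry.Lorentzian

namespace MetricCoord

variable {E : Type*} [NormedAddCommGroup E] [NormedSpace ℝ E] [FiniteDimensional ℝ E]
  [CompleteSpace E] {G : E → E →L[ℝ] E →L[ℝ] ℝ} {V : Set E} {x : E} {f : E → ℝ}

/-- **The Hamilton–Ivey quantity at a cut-off maximum, point inequality** (see the module
docstring): on a three-dimensional gradient shrinking soliton `Ric + Hess f = ½ G` in coordinates,
at a point `x` where the cut-off affine pinching
`Θ(f y)(c₀ G_y(w,w) + 2α Ric_y(w,w) + κ S(y) G_y(w,w)) ≤ u₀ G_y(w,w)` holds on `V` with equality at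
`(x, e₀)`, `e` an orthonormal eigenframe of `Ric_x` (eigenvalues `μ`), `Θ(f x) > 0`:
`Θ(2α T_Ric + κ T_S) ≤ −L₀(Θ''|∇f|² + Θ'(3/2 − S − |∇f|²)) + 2Θ'²|∇f|² L₀/Θ` with
`T_Ric = μ₀ − μ₁(μ₀+μ₁−μ₂) − μ₂(μ₀+μ₂−μ₁)`, `T_S = S − 2Σμᵢ²`, `L₀ = c₀ + 2αμ₀ + κS`.
[cite: Hamilton1995, §24, Thm. 24.4] [cite: Chen2009, Cor. 2.4]
[cite: EminentiLanaveMantegazza2008, §3 (p. 7)] -/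
theorem IsMetricOn.hamiltonIvey_at_cutoff_maximum (hG : IsMetricOn G V) (hx : x ∈ V)
    (hpos : ∀ w : E, w ≠ 0 → 0 < G x w w) (h3 : finrank ℝ E = 3) (hf : ContDiffOn ℝ ∞ f V)
    (hsol : ∀ y ∈ V, ∀ v w, ricAt G y v w + hessAt G f y v w = (1 / 2 : ℝ) * G y v w)
    (e : Basis (Fin 3) ℝ E) (he : ∀ i j, G x (e i) (e j) = if i = j then 1 else 0)
    {μ : Fin 3 → ℝ} (hμ : ∀ i w, ricAt G x (e i) w = μ i * G x (e i) w)
    {Θ Θ' Θ'' : ℝ → ℝ} (hΘ : ∀ t, HasDerivAt Θ (Θ' t) t) (hΘ' : ∀ t, HasDerivAt Θ' (Θ'' t) t)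
    (hΘpos : 0 < Θ (f x)) {c₀ α κ u₀ : ℝ}
    (hle : ∀ y ∈ V, ∀ w, Θ (f y) * (c₀ * G y w w + 2 * α * ricAt G y w w
      + κ * scalAt G y * G y w w) ≤ u₀ * G y w w)
    (heq : Θ (f x) * (c₀ + 2 * α * μ 0 + κ * scalAt G x) = u₀) :
    Θ (f x) * (2 * α * (μ 0 - μ 1 * (μ 0 + μ 1 - μ 2) - μ 2 * (μ 0 + μ 2 - μ 1))
        + κ * (scalAt G x - 2 * (μ 0 ^ 2 + μ 1 ^ 2 + μ 2 ^ 2))) ≤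
      -(c₀ + 2 * α * μ 0 + κ * scalAt G x)
          * (Θ'' (f x) * fderiv ℝ f x (sharpAt G x (fderiv ℝ f x))
            + Θ' (f x) * (3 / 2 - scalAt G x - fderiv ℝ f x (sharpAt G x (fderiv ℝ f x))))
        + 2 * Θ' (f x) ^ 2 * fderiv ℝ f x (sharpAt G x (fderiv ℝ f x))
          * (c₀ + 2 * α * μ 0 + κ * scalAt G x) / Θ (f x) := by
  have hi := hG.isInvertible x hx
  have he00 : G x (e 0) (e 0) = 1 := by rw [he]; simp
  have hμ00 : ricAt G x (e 0) (e 0) = μ 0 := by rw [hμ, he00, mul_one]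
  -- the maximum-point conditions, for `β = Ric`, `S = scalAt`, `v = e 0`
  have heq' : Θ (f x) * (c₀ * G x (e 0) (e 0) + 2 * α * ricAt G x (e 0) (e 0)
      + κ * scalAt G x * G x (e 0) (e 0)) = u₀ * G x (e 0) (e 0) := by
    rw [he00, hμ00, mul_one, mul_one, mul_one, heq]
  obtain ⟨hfirst, hsecond⟩ := hG.cutoff_affine_maximum_laplacian hx hpos hG.contDiffOn_ricAt
    hG.contDiffOn_scalAt hf hΘ hΘ' hle heq'
  -- Hamilton's identities at `x`
  have hlapS := hG.lapAt_scalAt_of_soliton hx hf hsol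
  have hlapR := hG.lapBilinAt_ricAt_self_of_soliton_eigenframe e he hμ hx hf hsol
  have hnorm := hG.normSqAt_ricAt_eq_sum_of_eigenframe e he hμ hx
  have htrace : scalAt G x + lapAt G f x = (1 / 2 : ℝ) * finrank ℝ E :=
    scalAt_add_lapAt_of_soliton hi (hsol x hx)
  have hlapf : lapAt G f x = 3 / 2 - scalAt G x := by
    rw [h3] at htrace
    push_cast at htrace
    linarith
  -- the first-order condition in the direction `∇f`
  have hX := hfirst (sharpAt G x (fderiv ℝ f x))
  rw [he00, hμ00, mul_one, mul_one, mul_one] at hX hsecond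
  rw [hlapS, hnorm, Fin.sum_univ_three, hlapf] at hsecond
  -- abbreviations
  set g := fderiv ℝ f x (sharpAt G x (fderiv ℝ f x)) with hg
  set L₀ := c₀ + 2 * α * μ 0 + κ * scalAt G x with hL₀
  set Cf := cov₂At G (ricAt G) x (sharpAt G x (fderiv ℝ f x)) (e 0) (e 0) with hCf
  set Df := fderiv ℝ (scalAt G) x (sharpAt G x (fderiv ℝ f x)) with hDf
  set Θ₀ := Θ (f x) with hΘ₀
  set Θ₁ := Θ' (f x) with hΘ₁
  set Θ₂ := Θ'' (f x) with hΘ₂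
  -- `Θ₀ (2α Cf + κ Df) = −Θ₁ g L₀`
  have hfo : Θ₀ * (2 * α * Cf + κ * Df) = -(Θ₁ * g * L₀) := by
    have h := hX
    linarith
  -- the rough Laplacian of `Ric` on `e₀`
  have hlapR' : lapBilinAt G (ricAt G) x (e 0) (e 0) =
      Cf + (2 * (1 / 2) * μ 0 - μ 1 * (μ 0 + μ 1 - μ 2) - μ 2 * (μ 0 + μ 2 - μ 1)) := by
    rw [hCf]; linarith
  rw [hlapR'] at hsecond
  -- eliminate `Cf`, `Df` using `hfo`
  have hne : Θ₀ ≠ 0 := hΘpos.ne'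
  have hY : 2 * α * Cf + κ * Df = -(Θ₁ * g * L₀) / Θ₀ := by
    rw [eq_div_iff hne]
    linarith [hfo]
  have hlast : Θ₀ * (2 * α * (Cf + (2 * (1 / 2) * μ 0 - μ 1 * (μ 0 + μ 1 - μ 2)
        - μ 2 * (μ 0 + μ 2 - μ 1)))
      + κ * (Df + 2 * (1 / 2) * scalAt G x - 2 * (μ 0 ^ 2 + μ 1 ^ 2 + μ 2 ^ 2)) * 1) =
      -(Θ₁ * g * L₀) + Θ₀ * (2 * α * (μ 0 - μ 1 * (μ 0 + μ 1 - μ 2) - μ 2 * (μ 0 + μ 2 - μ 1))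
        + κ * (scalAt G x - 2 * (μ 0 ^ 2 + μ 1 ^ 2 + μ 2 ^ 2))) := by
    linear_combination hfo
  rw [hY, hlast] at hsecond
  have hdiv : 2 * (Θ₁ * (-(Θ₁ * g * L₀) / Θ₀)) = -(2 * Θ₁ ^ 2 * g * L₀ / Θ₀) := by
    field_simp
  rw [hdiv] at hsecond
  linarith [hsecond]

end MetricCoord

end Literature.Geometry.Lorentzian

end
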